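import Literature.NumberTheory.LFunctions.FeketePolyaKernelCertificatesBlockWrappers
import HarnessLib

/-!
# No real zero for real primitive characters of conductor `42907 ≤ q ≤ 42946`: the Fekete–Pólya rows, in the kernel

Topic `Literature/NumberTheory/LFunctions`; namespace `Literature.NumberTheory.LFunctions`. THEOREMS only (no
definition, no named fact, no `sorry`; standard axioms): one PUBLIC theorem **`noRealZero{Odd,Even}_fp_<q>`** per
fundamental discriminant `D`, `|D| = q ∈ [42907, 42946]`, that admits a Fekete–Pólya witness (here: along an induced modulus `q·w` with `40 < w ≤ 100` or `q·w > 4·10⁵`, found by the extended scan of the rows the base scan `w ≤ 40, q·w ≤ 4·10⁵` had left to the companion lane) — for every primitive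
quadratic `χ` mod `q` of the parity of `D` and every `σ ∈ (0, 1)`, `L(σ, χ) ≠ 0` (statement shape of the
`interval_cases` bullets of the `NoRealZero{Odd,Even}…` range files, so a range assembly cites them by name).
Cell `parity-realchar`, kernel floor of the wide column (TARGET §2 row 19), Fekete–Pólya lane (seat prover-2).

Method (engine v4): `FeketePolyaKernelCertificatesBlock{,Wrappers}.lean` — the iterated partial sums of order
`K` of the induced character `χ↑(q·w)` are non-negative over one period, decided in the kernel BLOCKWISE on packed
base-`2^b` digits (`blockCert b B K (q·w) (tabs… b ps q w)`: sign tables of the character from the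
quadratic-residue bitsets of the prime factors of the conductor — the factor list is part of each certificate,
primality by `norm_num` — prefix sums by one big-integer multiplication per order and block, sign test by one
AND), hence `ℜL(σ, χ↑(q·w)) > 0` (Fekete–Pólya 1912 / MV §11.2.1 Exercise 7) and `L(σ, χ) ≠ 0` (positive Euler
factors, Exercise 8).  Witnesses `(w, K)` = the cheapest in the exact integer scan of this seat
(`HOME/parity-realchar-prover-2/fp-witnesses-*.tsv`; no kit); the digit width `b` is two bits above the size of
the running-sum bound recorded by the scan.  1 characters in this file (est. 41 kernel-s).
Only the rows of this range RESCUED by the extended scan appear in this file (the base-scan rows are in the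
`NoRealZeroFeketePolyaX…` files; the rest stays with the truncation certificates of the companion lane).

## References

* H. L. Montgomery, R. C. Vaughan, *Multiplicative Number Theory I*, CUP 2007, §9.3 Thm 9.13, §11.2.1
  Exercises 7–8. [MontgomeryVaughan2007]
* M. Fekete, G. Pólya, *Über ein Problem von Laguerre*, Rend. Circ. Mat. Palermo 34 (1912) 89–120. [FeketePolya1912]
-/

namespace Literature.NumberTheory.LFunctions

open FeketePolyaKernel

set_option maxHeartbeats 400000 in
/-- `D = -42907`: the odd character `(·/42907)` of conductor `42907` (`42907`: 107 · 401) — Fekete–Pólya witness of order `6` along the induced modulus `42907·30 = 1287210`, block certificate (digits of `105` bits, splitting depth `13`); est. `40.5` kernel-s. [cite: MontgomeryVaughan2007, §11.2.1 Exercises 7 (g), 8] -/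
theorem noRealZeroOdd_fp_42907 :
    ∀ χ : DirichletCharacter ℂ 42907, χ.IsQuadratic → χ.IsPrimitive → χ.Odd →
      ∀ σ : ℝ, 0 < σ → σ < 1 → χ.LFunction σ ≠ 0 :=
  good_odd_of_odd_blk [107, 401] (by norm_num) (by decide) (by decide) 30 6 105 13 (by decide) (by decide) (by decide)
    (Or.inr (by decide +kernel))

end Literature.NumberTheory.LFunctions
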